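import Literature.MathematicalPhysics.QuantumLattice.LatticeGaugeDLR
import Literature.MathematicalPhysics.QuantumLattice.AbelianFieldTensor
import HarnessLib

/-!
# Lüscher's abelian field tensor on the infinite lattice `ℤ^d`

The infinite-lattice twin of `AbelianFieldTensor.lean` / `AbelianBianchiIdentity.lean`, in the
setting in which Lüscher's classification theorem is actually stated
([Luscher1999AbelianTopology] M. Lüscher, *Topology and the axial anomaly in abelian lattice gauge
theories*, Nucl. Phys. B 538 (1999) 515, arXiv:hep-lat/9808021): `U(1)` lattice gauge fields on
`ℤ^d` are the tree's `LGConfig d Circle` (`LatticeGaugeDLR.lean`: a `Circle` element on every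
positively oriented edge, plaquette holonomy `plaquetteHolonomyZd`, gauge transformations
`gaugeTransformZd`), and

* `abelianFieldTensorZd U x μ ν = Complex.arg (P(x,μ,ν))` is the field tensor
  `F_{μν}(x) = (1/i) ln P(x,μ,ν) ∈ (−π, π]` of eqs. (3.3)–(3.4); admissibility (3.5) is the
  hypothesis `∀ x μ ν, |F_{μν}(x)| < ε`, `0 < ε < π/3`, written out where needed;
* `abelianFieldTensorZd_gaugeTransformZd` — `F` is gauge invariant (§3);
* `plaquetteHolonomyZd_cube`, `abelianFieldTensorZd_bianchi` — the cube identity and the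
  **lattice Bianchi identity** `∂_ν F_{ρσ} + ∂_ρ F_{σν} + ∂_σ F_{νρ} = 0` for `|F| < π/3`
  (§3: "the magnetic monopole current `ε_{μνρσ} ∂_ν F_{ρσ}` ... can be shown to vanish if the
  bound (3.5) holds"); `abelianFieldTensorZd_swap` — antisymmetry off the cut;
* `epsFFZd U x = Σ ε_{μνρσ} F_{μν}(x) F_{ρσ}(x+μ̂+ν̂)` — the quadratic density of the
  classification theorem (1.4) (`d = 4`), and its gauge invariance.

Definitions with bodies and proved theorems only; no named facts. (The classification theorem
(1.4) itself — for gauge-invariant local topological fields `q(x) = α + β_{μν}F_{μν}(x) +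
γ εFF(x) + ∂*_μ k_μ(x)` — is NOT stated here; this file only supplies its vocabulary.)

## References

* M. Lüscher, Nucl. Phys. B 538 (1999) 515–529, arXiv:hep-lat/9808021, §3 eqs. (3.3)–(3.5),
  eq. (1.4). [Luscher1999AbelianTopology]
-/

noncomputable section

open Finset
open Literature.Probability.LatticeModels (Site)

namespace Literature.MathematicalPhysics.QuantumLattice

section FieldTensorZd

variable {d : ℕ}

/-- **Lüscher's abelian field tensor on `ℤ^d`**: `F_{μν}(x) = (1/i) ln P(x,μ,ν) ∈ (−π, π]`, the
principal logarithm of the plaquette holonomy of a `U(1)` gauge field on the infinite lattice.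
[cite: Luscher1999AbelianTopology, eqs. (3.3)–(3.4)] -/
def abelianFieldTensorZd (U : LGConfig d Circle) (x : Site d) (μ ν : Fin d) : ℝ :=
  Complex.arg ((plaquetteHolonomyZd U x μ ν : Circle) : ℂ)

/-- `−π < F_{μν}(x)`. [cite: Luscher1999AbelianTopology, eq. (3.4)] -/
theorem neg_pi_lt_abelianFieldTensorZd (U : LGConfig d Circle) (x : Site d) (μ ν : Fin d) :
    -Real.pi < abelianFieldTensorZd U x μ ν :=
  Complex.neg_pi_lt_arg _

/-- `F_{μν}(x) ≤ π`. [cite: Luscher1999AbelianTopology, eq. (3.4)] -/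
theorem abelianFieldTensorZd_le_pi (U : LGConfig d Circle) (x : Site d) (μ ν : Fin d) :
    abelianFieldTensorZd U x μ ν ≤ Real.pi :=
  Complex.arg_le_pi _

/-- `P(x,μ,ν) = exp(i F_{μν}(x))`. [cite: Luscher1999AbelianTopology, eq. (3.4)] -/
theorem exp_abelianFieldTensorZd (U : LGConfig d Circle) (x : Site d) (μ ν : Fin d) :
    Circle.exp (abelianFieldTensorZd U x μ ν) = plaquetteHolonomyZd U x μ ν :=
  Circle.exp_arg _

/-- The plaquette of a `U(1)` field is gauge invariant (abelian group). [cite: Luscher1999AbelianTopology, §3] -/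
theorem plaquetteHolonomyZd_gaugeTransformZd_of_comm {G : Type*} [CommGroup G] (g : Site d → G)
    (U : LGConfig d G) (x : Site d) (μ ν : Fin d) :
    plaquetteHolonomyZd (gaugeTransformZd g U) x μ ν = plaquetteHolonomyZd U x μ ν := by
  rw [plaquetteHolonomyZd_gaugeTransformZd, mul_inv_cancel_comm]

/-- **`F_{μν}` is gauge invariant.** [cite: Luscher1999AbelianTopology, §3] -/
theorem abelianFieldTensorZd_gaugeTransformZd (g : Site d → Circle) (U : LGConfig d Circle)
    (x : Site d) (μ ν : Fin d) :
    abelianFieldTensorZd (gaugeTransformZd g U) x μ ν = abelianFieldTensorZd U x μ ν := by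
  rw [abelianFieldTensorZd, abelianFieldTensorZd, plaquetteHolonomyZd_gaugeTransformZd_of_comm]

/-- `‖1 − P(x,μ,ν)‖ = 2|sin(F_{μν}(x)/2)|` (chord versus arc), linking `|F| < ε` to the
small-field condition on `‖1 − P‖`. [folklore] -/
theorem norm_one_sub_coe_plaquetteZd_eq (U : LGConfig d Circle) (x : Site d) (μ ν : Fin d) :
    ‖(1 : ℂ) - ((plaquetteHolonomyZd U x μ ν : Circle) : ℂ)‖ =
      2 * |Real.sin (abelianFieldTensorZd U x μ ν / 2)| := by
  conv_lhs => rw [← exp_abelianFieldTensorZd U x μ ν, Circle.coe_exp]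
  exact norm_one_sub_cexp_mul_I _

/-! ### Cube identity, Bianchi identity, antisymmetry -/

/-- **The cube identity on `ℤ^d`** (abelian gauge group): the six oriented plaquettes of an
elementary cube multiply to `1`. [cite: Luscher1999AbelianTopology, §3] -/
theorem plaquetteHolonomyZd_cube {G : Type*} [CommGroup G] (U : LGConfig d G) (x : Site d)
    (ν ρ σ : Fin d) :
    plaquetteHolonomyZd U (x + Pi.single ν 1) ρ σ * (plaquetteHolonomyZd U x ρ σ)⁻¹ *
      (plaquetteHolonomyZd U (x + Pi.single ρ 1) σ ν * (plaquetteHolonomyZd U x σ ν)⁻¹) *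
      (plaquetteHolonomyZd U (x + Pi.single σ 1) ν ρ * (plaquetteHolonomyZd U x ν ρ)⁻¹) = 1 := by
  simp only [plaquetteHolonomyZd, add_comm, add_left_comm]
  rw [← ofMul_eq_zero]
  simp only [ofMul_mul, ofMul_inv]
  abel

/-- **Lattice Bianchi identity on `ℤ^d`**: if `|F| < π/3` everywhere (admissibility (3.5)), then
`∂_ν F_{ρσ}(x) + ∂_ρ F_{σν}(x) + ∂_σ F_{νρ}(x) = 0` with `∂_ν f(x) = f(x+ν̂) − f(x)` — the
magnetic monopole current `ε_{μνρσ}∂_ν F_{ρσ}` vanishes for admissible fields.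
[cite: Luscher1999AbelianTopology, §3 (the paragraph after (3.5))] -/
theorem abelianFieldTensorZd_bianchi (U : LGConfig d Circle) (x : Site d) (ν ρ σ : Fin d)
    (hF : ∀ (y : Site d) (α β : Fin d), |abelianFieldTensorZd U y α β| < Real.pi / 3) :
    abelianFieldTensorZd U (x + Pi.single ν 1) ρ σ - abelianFieldTensorZd U x ρ σ +
      (abelianFieldTensorZd U (x + Pi.single ρ 1) σ ν - abelianFieldTensorZd U x σ ν) +
      (abelianFieldTensorZd U (x + Pi.single σ 1) ν ρ - abelianFieldTensorZd U x ν ρ) = 0 := by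
  set S := abelianFieldTensorZd U (x + Pi.single ν 1) ρ σ - abelianFieldTensorZd U x ρ σ +
      (abelianFieldTensorZd U (x + Pi.single ρ 1) σ ν - abelianFieldTensorZd U x σ ν) +
      (abelianFieldTensorZd U (x + Pi.single σ 1) ν ρ - abelianFieldTensorZd U x ν ρ) with hS
  have hexp : Circle.exp S = 1 := by
    simp only [hS, Circle.exp_add, Circle.exp_sub, exp_abelianFieldTensorZd, div_eq_mul_inv]
    exact plaquetteHolonomyZd_cube U x ν ρ σ
  obtain ⟨n, hn⟩ := Circle.exp_eq_one.mp hexp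
  have hbound : |S| < 2 * Real.pi := by
    have h1 := hF (x + Pi.single ν 1) ρ σ
    have h2 := hF x ρ σ
    have h3 := hF (x + Pi.single ρ 1) σ ν
    have h4 := hF x σ ν
    have h5 := hF (x + Pi.single σ 1) ν ρ
    have h6 := hF x ν ρ
    rw [abs_lt] at h1 h2 h3 h4 h5 h6 ⊢
    constructor <;> linarith
  have hn0 : n = 0 := by
    rw [hn, abs_lt] at hbound
    have hπ := Real.pi_pos
    have h1 : (n : ℝ) < 1 := by nlinarith
    have h2 : (-1 : ℝ) < n := by nlinarith
    have h1' : n < 1 := by exact_mod_cast h1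
    have h2' : -1 < n := by exact_mod_cast h2
    omega
  rw [hn, hn0, Int.cast_zero, zero_mul]

/-- `P(x,ν,μ) = P(x,μ,ν)⁻¹` on `ℤ^d` (abelian gauge group). [folklore] -/
theorem plaquetteHolonomyZd_swap_eq_inv {G : Type*} [CommGroup G] (U : LGConfig d G) (x : Site d)
    (μ ν : Fin d) : plaquetteHolonomyZd U x ν μ = (plaquetteHolonomyZd U x μ ν)⁻¹ := by
  simp only [plaquetteHolonomyZd]
  rw [eq_inv_iff_mul_eq_one, ← ofMul_eq_zero]
  simp only [ofMul_mul, ofMul_inv]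
  abel

/-- Antisymmetry off the cut: `F_{νμ}(x) = −F_{μν}(x)` whenever `F_{μν}(x) ≠ π`.
[cite: Luscher1999AbelianTopology, §3 (3.4)] -/
theorem abelianFieldTensorZd_swap (U : LGConfig d Circle) (x : Site d) (μ ν : Fin d)
    (h : abelianFieldTensorZd U x μ ν ≠ Real.pi) :
    abelianFieldTensorZd U x ν μ = -abelianFieldTensorZd U x μ ν := by
  unfold abelianFieldTensorZd at h ⊢
  rw [plaquetteHolonomyZd_swap_eq_inv U x μ ν, Circle.coe_inv, Complex.arg_inv, if_neg h]

end FieldTensorZd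

/-! ### The `ε F F` density of the classification theorem on `ℤ⁴` -/

section ChargeZd

/-- **The quadratic density of Lüscher's theorem (1.4) on `ℤ⁴`**:
`(εFF)(x) = Σ_{μνρσ} ε_{μνρσ} F_{μν}(x) F_{ρσ}(x + μ̂ + ν̂)`. [cite: Luscher1999AbelianTopology, eq. (1.4)] -/
def epsFFZd (U : LGConfig 4 Circle) (x : Site 4) : ℝ :=
  ∑ μ : Fin 4, ∑ ν : Fin 4, ∑ ρ : Fin 4, ∑ σ : Fin 4,
    (leviCivita4 ![μ, ν, ρ, σ] : ℝ) * abelianFieldTensorZd U x μ ν *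
      abelianFieldTensorZd U (x + Pi.single μ 1 + Pi.single ν 1) ρ σ

/-- The `ε F F` density is gauge invariant. [cite: Luscher1999AbelianTopology, §3] -/
theorem epsFFZd_gaugeTransformZd (g : Site 4 → Circle) (U : LGConfig 4 Circle) (x : Site 4) :
    epsFFZd (gaugeTransformZd g U) x = epsFFZd U x := by
  simp only [epsFFZd, abelianFieldTensorZd_gaugeTransformZd]

/-- Gauge invariance in the tree's `IsZdGaugeInvariant` form. [cite: Luscher1999AbelianTopology, §3] -/
theorem isZdGaugeInvariant_epsFFZd (x : Site 4) :
    IsZdGaugeInvariant (fun U : LGConfig 4 Circle => epsFFZd U x) :=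
  fun g U => epsFFZd_gaugeTransformZd g U x

end ChargeZd

end Literature.MathematicalPhysics.QuantumLattice
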